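import Summits.PneNP.PneNP.Theorems.OneSliceConstantBandTransferStepAux

/-!
# `ConstantBand` (stmt-PneNP-2834) — negative-side lemmas: the δ-floor `δ ≤ (2w+1)/k!` and the bottom window

On a central slice the `k`-clique density is `≤ (1+o(1))/k!` (first moment) and a fixed edge is on with probability
`i/C(n,2) → 0`, so the GATE-FREE projection `x_{e₀}` has band error `≤ (2w+1)/k! + o(1)`. Consequences:

* `not_bandLB_of_delta_gt` — for `k ≥ 3` and EVERY exponent `c`: `δ > (2w+1)/k! ⟹ ¬ BandLB c k w δ`;
  `delta_le_of_bandLB` — every witness `(k, w, δ)` of `ConstantBand` has `δ ≤ (2w+1)/k!`: the accuracy demanded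
  must shrink factorially in `k`, while `k ≥ c - 2` (`ExponentVsK.le_of_bandLB`) must grow with the exponent.
* `not_withoutCentral_zero` — the BOTTOM window: the centrality-free variant of the crux (top end refuted in
  `LoadBearing.constantBand_false_without_central`) fails already at exponent `0` (`j = 0`, circuit `x_{e₀}`):
  the window is load-bearing at both ends.

The slice-counting toolkit (`#slice_i = C(C(n,2),i)`, hypergeometric tail, first moment, window bookkeeping) first
written in `Cruxes/ConstantBand/Disproof.lean` §4 is REUSED from its landed copy
`Theorems/OneSliceConstantBandTransferStepAux.lean` (`ts_*`, namespace `…Cruxes.ConstantBand.FlatPriorRelativeMinterms`).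
Refuter seat cdisprove-stmt-PneNP-2834 (gen 1), 2026-08-16.
-/

set_option linter.dupNamespace false

namespace Summit.PneNP.PneNP.Theorems.ConstantBand.Negative

open Literature.Computability.Complexity Filter Finset Classical
open Summit.PneNP.PneNP.Cruxes.ConstantBand.FlatPriorRelativeMinterms
open scoped Topology

variable {n : ℕ}

/-- The error set of the projection `x_{e₀}` on a slice: `x_{e₀} ≠ CLIQUE_k(x)` forces `x_{e₀} = 1` or a `k`-clique.
[folklore] -/
theorem errSet_input_subset (e₀ : Edge n) (k i : ℕ) :
    errSet n k i (Circuit.input e₀) ⊆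
      ((slice n i).filter fun x => ∀ e ∈ ({e₀} : Finset (Edge n)), x e = true) ∪
        ((slice n i).filter fun x => cliqueFn n k x = true) := by
  intro x hx
  obtain ⟨hcount, hne⟩ := ts_mem_errSet.1 hx
  rw [Circuit.eval_input] at hne
  have hxs : x ∈ slice n i := ts_mem_slice.2 hcount
  rw [mem_union]
  cases h0 : x e₀ with
  | true => exact Or.inl (mem_filter.2 ⟨hxs, by simpa using h0⟩)
  | false =>
    refine Or.inr (mem_filter.2 ⟨hxs, ?_⟩)
    cases h1 : cliqueFn n k x with
    | true => rfl
    | false => exact absurd (h0.trans h1.symm) hne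

/-- **First-moment bound on a slice**: the error fraction of `x_{e₀}` against `CLIQUE_k` on slice `i ≤ C(n,2)` is
at most `i/C(n,2) + C(n,k)·(i/C(n,2))^{C(k,2)}`. [folklore] -/
theorem errFrac_input_le (e₀ : Edge n) {k i : ℕ} (hi : i ≤ n.choose 2) (hN : 0 < n.choose 2) :
    (#(errSet n k i (Circuit.input e₀)) : ℝ) / #(slice n i) ≤
      (i : ℝ) / n.choose 2 + (n.choose k : ℝ) * ((i : ℝ) / n.choose 2) ^ k.choose 2 := by
  have hs : 0 < (#(slice n i) : ℝ) := by exact_mod_cast ts_card_slice_pos hi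
  have hcard := (card_le_card (errSet_input_subset e₀ k i)).trans (card_union_le _ _)
  have h1 := ts_frac_slice_filter_supset_le ({e₀} : Finset (Edge n)) hi hN
  rw [card_singleton, pow_one] at h1
  have h2 := ts_sliceFrac_clique_le (k := k) hi hN
  calc (#(errSet n k i (Circuit.input e₀)) : ℝ) / #(slice n i)
      ≤ ((#((slice n i).filter fun x => ∀ e ∈ ({e₀} : Finset (Edge n)), x e = true) +
          #((slice n i).filter fun x => cliqueFn n k x = true) : ℕ) : ℝ) / #(slice n i) :=
        div_le_div_of_nonneg_right (by exact_mod_cast hcard) hs.le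
    _ ≤ _ := by
        push_cast
        rw [add_div]
        exact add_le_add h1 h2

/-- **Pointwise window bound.** With `θ = n^{-2/(k-1)}`: if `i ≤ C(n,2)·θ·b` (`b ≥ 0`) then the error fraction of
`x_{e₀}` on slice `i` is at most `θ·b + b^{C(k,2)}/k!` (`C(n,k)·θ^{C(k,2)} ≤ 1/k!`; empty slices contribute `0`).
[folklore] -/
theorem errFrac_input_le_of_window {k n i : ℕ} (hk : 2 ≤ k) (hn : 2 ≤ n) {b : ℝ} (hb : 0 ≤ b)
    (hi : (i : ℝ) ≤ (n.choose 2 : ℝ) * (n : ℝ) ^ (-(2 : ℝ) / ((k : ℝ) - 1)) * b) (e₀ : Edge n) :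
    (#(errSet n k i (Circuit.input e₀)) : ℝ) / #(slice n i) ≤
      (n : ℝ) ^ (-(2 : ℝ) / ((k : ℝ) - 1)) * b + b ^ k.choose 2 / k.factorial := by
  have hN : 0 < n.choose 2 := Nat.choose_pos hn
  have hNr : (0 : ℝ) < n.choose 2 := by exact_mod_cast hN
  have hθ0 : 0 ≤ (n : ℝ) ^ (-(2 : ℝ) / ((k : ℝ) - 1)) := Real.rpow_nonneg (Nat.cast_nonneg _) _
  by_cases hiN : i ≤ n.choose 2
  · have hq : (i : ℝ) / n.choose 2 ≤ (n : ℝ) ^ (-(2 : ℝ) / ((k : ℝ) - 1)) * b := by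
      rw [div_le_iff₀ hNr]
      linarith
    have hq0 : (0 : ℝ) ≤ (i : ℝ) / n.choose 2 := by positivity
    calc (#(errSet n k i (Circuit.input e₀)) : ℝ) / #(slice n i)
        ≤ (i : ℝ) / n.choose 2 + (n.choose k : ℝ) * ((i : ℝ) / n.choose 2) ^ k.choose 2 :=
          errFrac_input_le e₀ hiN hN
      _ ≤ (n : ℝ) ^ (-(2 : ℝ) / ((k : ℝ) - 1)) * b +
            (n.choose k : ℝ) * ((n : ℝ) ^ (-(2 : ℝ) / ((k : ℝ) - 1)) * b) ^ k.choose 2 :=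
          add_le_add hq (mul_le_mul_of_nonneg_left (pow_le_pow_left₀ hq0 hq _) (Nat.cast_nonneg _))
      _ = (n : ℝ) ^ (-(2 : ℝ) / ((k : ℝ) - 1)) * b +
            (n.choose k : ℝ) * ((n : ℝ) ^ (-(2 : ℝ) / ((k : ℝ) - 1))) ^ k.choose 2 * b ^ k.choose 2 := by
          rw [mul_pow]; ring
      _ ≤ (n : ℝ) ^ (-(2 : ℝ) / ((k : ℝ) - 1)) * b + 1 / k.factorial * b ^ k.choose 2 :=
          add_le_add le_rfl
            (mul_le_mul_of_nonneg_right (ts_choose_mul_θ_pow_le hk (by omega)) (pow_nonneg hb _))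
      _ = _ := by ring
  · have h0 : errSet n k i (Circuit.input e₀) = ∅ := by
      refine filter_eq_empty_iff.2 fun x _ hx => hiN ?_
      rw [← hx.1, edgeCount, ← card_edgeSet_top_fin n, ← card_univ]
      exact card_le_card (filter_subset _ _)
    rw [h0, card_empty, Nat.cast_zero, zero_div]
    positivity

/-- The gate-free projection circuit is (vacuously) over the monotone basis. [folklore] -/
theorem input_isOver (e₀ : Edge n) : (Circuit.input e₀ : Circuit (Edge n)).IsOver monotoneBasis := by
  intro g hg
  simp [Circuit.input] at hg

/-- **The δ-floor.** For `k ≥ 3` and ANY exponent `c`: if `δ > (2w+1)/k!` then `BandLB c k w δ` is false — the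
gate-free circuit `x_{e₀}` is `δ`-accurate on every central band eventually (per slice
`≤ θ(1 + T^{-1/4} + w/T) + (1 + T^{-1/4} + w/T)^{C(k,2)}/k! → 1/k!`, `T = C(n,2)·n^{-2/(k-1)} → ∞`). [folklore] -/
theorem not_bandLB_of_delta_gt {c k w : ℕ} {δ : ℝ} (hk : 3 ≤ k)
    (hδ : (2 * w + 1 : ℝ) / k.factorial < δ) : ¬ BandLB c k w δ := by
  intro H
  obtain ⟨T, hTdef⟩ : ∃ T : ℕ → ℝ, ∀ n : ℕ,
      T n = ((n.choose 2 : ℕ) : ℝ) * (n : ℝ) ^ (-(2 : ℝ) / ((k : ℝ) - 1)) := ⟨_, fun _ => rfl⟩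
  have hT : Tendsto T atTop atTop := (ts_tendsto_T hk).congr fun n => (hTdef n).symm
  have hθ : Tendsto (fun n : ℕ => (n : ℝ) ^ (-(2 : ℝ) / ((k : ℝ) - 1))) atTop (𝓝 0) :=
    tendsto_rpow_threshold (k := k) (by omega)
  have hb := ts_tendsto_upper hT w
  -- the per-slice bound tends to `1/k!`
  have hB : Tendsto (fun n : ℕ => (n : ℝ) ^ (-(2 : ℝ) / ((k : ℝ) - 1)) *
      (1 + (T n) ^ (-(1 / 4 : ℝ)) + (w : ℝ) / T n) +
        (1 + (T n) ^ (-(1 / 4 : ℝ)) + (w : ℝ) / T n) ^ k.choose 2 / k.factorial)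
      atTop (𝓝 (1 / k.factorial)) := by
    have h := (hθ.mul hb).add ((hb.pow (k.choose 2)).div_const (k.factorial : ℝ))
    simp only [zero_mul, one_pow, zero_add] at h
    exact h
  have hw : (0 : ℝ) < 2 * w + 1 := by positivity
  have hδ' : 1 / (k.factorial : ℝ) < δ / (2 * w + 1) := by
    rw [lt_div_iff₀ hw]
    have : 1 / (k.factorial : ℝ) * (2 * w + 1) = (2 * w + 1) / k.factorial := by ring
    rw [this]
    exact hδ
  have hev := (tendsto_order.1 hB).2 _ hδ'
  have hTev : ∀ᶠ n : ℕ in atTop, 1 ≤ T n := hT.eventually_ge_atTop 1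
  obtain ⟨n, hn, hBn, hT1, hn2⟩ := (H.and (hev.and (hTev.and (eventually_ge_atTop 2)))).exists
  have hN : 0 < n.choose 2 := Nat.choose_pos hn2
  have hT0 : 0 < T n := by linarith
  obtain ⟨e₀, -⟩ : (univ : Finset (Edge n)).Nonempty := by
    rw [← card_pos, card_univ, card_edgeSet_top_fin]; exact hN
  have hb0 : 0 ≤ 1 + (T n) ^ (-(1 / 4 : ℝ)) + (w : ℝ) / T n := by
    have : 0 ≤ (T n) ^ (-(1 / 4 : ℝ)) := Real.rpow_nonneg hT0.le _
    have : 0 ≤ (w : ℝ) / T n := div_nonneg (Nat.cast_nonneg _) hT0.le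
    linarith
  have hδ0 : 0 < δ := lt_trans (by positivity) hδ
  have herr : bandErr n k (thr k n) w (Circuit.input e₀) ≤ δ := by
    have hj' := ts_central_iff.1 (central_thr k n)
    rw [← hTdef n] at hj'
    calc bandErr n k (thr k n) w (Circuit.input e₀)
        ≤ ∑ _i ∈ Icc (thr k n - w) (thr k n + w), δ / (2 * w + 1) := by
          refine sum_le_sum fun i hi => ?_
          have hup := ts_le_T_mul_upper hT0 hj' (mem_Icc.1 hi).2
          have hup' : (i : ℝ) ≤ (n.choose 2 : ℝ) * (n : ℝ) ^ (-(2 : ℝ) / ((k : ℝ) - 1)) *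
              (1 + (T n) ^ (-(1 / 4 : ℝ)) + (w : ℝ) / T n) := by rwa [← hTdef n]
          exact (errFrac_input_le_of_window (by omega) hn2 hb0 hup' e₀).trans hBn.le
      _ = #(Icc (thr k n - w) (thr k n + w)) * (δ / (2 * w + 1)) := by rw [sum_const, nsmul_eq_mul]
      _ ≤ (2 * w + 1) * (δ / (2 * w + 1)) := by
          refine mul_le_mul_of_nonneg_right ?_ (div_nonneg hδ0.le hw.le)
          have : #(Icc (thr k n - w) (thr k n + w)) ≤ 2 * w + 1 := by rw [Nat.card_Icc]; omega
          exact_mod_cast this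
      _ = δ := by field_simp
  have hlt := hn (thr k n) (central_thr k n) (Circuit.input e₀) (input_isOver e₀) herr
  simp at hlt

/-- **Corollary (necessary smallness of δ).** In every witness `(k, w, δ)` of the crux, `δ ≤ (2w+1)/k!`. [folklore] -/
theorem delta_le_of_bandLB {c k w : ℕ} {δ : ℝ} (hk : 3 ≤ k) (H : BandLB c k w δ) :
    δ ≤ (2 * w + 1 : ℝ) / k.factorial := by
  by_contra h
  exact not_bandLB_of_delta_gt hk (not_le.1 h) H

/-- **The bottom window is refuted at `c = 0`.** Without centrality, at `j = 0` the gate-free circuit `x_{e₀}` has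
band error `≤ (w+1)·(θ·(w/T) + (w/T)^{C(k,2)}/k!) → 0` (slices `i ≤ w = C(n,2)·θ·(w/T)`), so even the exponent-`0`
instance of the centrality-free variant of the crux is false: the window is load-bearing at BOTH ends (top end:
`constantBand_false_without_central`). [folklore] -/
theorem not_withoutCentral_zero :
    ¬ ∃ k : ℕ, 3 ≤ k ∧ ∃ w : ℕ, ∃ δ : ℝ, 0 < δ ∧ ∀ᶠ n : ℕ in atTop, ∀ j : ℕ,
      ∀ C : Circuit (Edge n), C.IsOver monotoneBasis → bandErr n k j w C ≤ δ → n ^ 0 < C.size := by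
  rintro ⟨k, hk, w, δ, hδ, H⟩
  obtain ⟨T, hTdef⟩ : ∃ T : ℕ → ℝ, ∀ n : ℕ,
      T n = ((n.choose 2 : ℕ) : ℝ) * (n : ℝ) ^ (-(2 : ℝ) / ((k : ℝ) - 1)) := ⟨_, fun _ => rfl⟩
  have hT : Tendsto T atTop atTop := (ts_tendsto_T hk).congr fun n => (hTdef n).symm
  have hθ : Tendsto (fun n : ℕ => (n : ℝ) ^ (-(2 : ℝ) / ((k : ℝ) - 1))) atTop (𝓝 0) :=
    tendsto_rpow_threshold (k := k) (by omega)
  have hwT : Tendsto (fun n => (w : ℝ) / T n) atTop (𝓝 0) := tendsto_const_nhds.div_atTop hT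
  have hB : Tendsto (fun n : ℕ => (n : ℝ) ^ (-(2 : ℝ) / ((k : ℝ) - 1)) * ((w : ℝ) / T n) +
      ((w : ℝ) / T n) ^ k.choose 2 / k.factorial) atTop (𝓝 0) := by
    have h := (hθ.mul hwT).add ((hwT.pow (k.choose 2)).div_const (k.factorial : ℝ))
    have hK : k.choose 2 ≠ 0 := (Nat.choose_pos (by omega : 2 ≤ k)).ne'
    simpa [zero_pow hK] using h
  have hw : (0 : ℝ) < w + 1 := by positivity
  have hev := (tendsto_order.1 hB).2 _ (div_pos hδ hw)
  have hTev : ∀ᶠ n : ℕ in atTop, 1 ≤ T n := hT.eventually_ge_atTop 1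
  obtain ⟨n, hn, hBn, hT1, hn2⟩ := (H.and (hev.and (hTev.and (eventually_ge_atTop 2)))).exists
  have hN : 0 < n.choose 2 := Nat.choose_pos hn2
  have hT0 : 0 < T n := by linarith
  obtain ⟨e₀, -⟩ : (univ : Finset (Edge n)).Nonempty := by
    rw [← card_pos, card_univ, card_edgeSet_top_fin]; exact hN
  have hb0 : 0 ≤ (w : ℝ) / T n := div_nonneg (Nat.cast_nonneg _) hT0.le
  have herr : bandErr n k 0 w (Circuit.input e₀) ≤ δ := by
    calc bandErr n k 0 w (Circuit.input e₀)
        ≤ ∑ _i ∈ Icc (0 - w) (0 + w), δ / (w + 1) := by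
          refine sum_le_sum fun i hi => ?_
          have hi' : i ≤ w := by have := (mem_Icc.1 hi).2; omega
          have hiw : (i : ℝ) ≤ (n.choose 2 : ℝ) * (n : ℝ) ^ (-(2 : ℝ) / ((k : ℝ) - 1)) * ((w : ℝ) / T n) := by
            rw [← hTdef n, mul_div_cancel₀ _ hT0.ne']
            exact_mod_cast hi'
          exact (errFrac_input_le_of_window (by omega) hn2 hb0 hiw e₀).trans hBn.le
      _ = #(Icc (0 - w) (0 + w)) * (δ / (w + 1)) := by rw [sum_const, nsmul_eq_mul]
      _ ≤ (w + 1) * (δ / (w + 1)) := by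
          refine mul_le_mul_of_nonneg_right ?_ (div_nonneg hδ.le hw.le)
          have : #(Icc (0 - w) (0 + w)) ≤ w + 1 := by rw [Nat.card_Icc]; omega
          exact_mod_cast this
      _ = δ := by field_simp
  have hlt := hn 0 (Circuit.input e₀) (input_isOver e₀) herr
  simp at hlt

end Summit.PneNP.PneNP.Theorems.ConstantBand.Negative
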